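import Literature.MathematicalPhysics.QuantumFieldTheory.Balaban1983to89.B9SectBH1GReadWriteY
import Literature.MathematicalPhysics.QuantumFieldTheory.Balaban1983to89.B9SectBGReadCodedY
import Literature.MathematicalPhysics.QuantumFieldTheory.Balaban1983to89.Node00.OpsYRead342CrossB

/-!
# `Balaban1983to89.B9SectBH1GProbesY` — the PAIR PROBES of the bond-sector (3.43) reading on r06's carrier `(κ × SiteY) × ι`: the input function `lamB`
# of a real coordinate vector, the bridges to the letters of the G frame (`GbC`, `∇_{U,ν}`, `∇*_{U,ν}`, the `diffLetter … η⁻¹ k` composites up to sign), block-support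
# tools, and ★★ the RIGHT-FORWARD CROSS word `G(U)∇_{U,ν}` (pub-ymgap N06 row 13, G side: bricks of the transfer field `H1GFrame₅.h1G_transfer` at NODE 00's letters)

T. Bałaban, *Propagators for lattice gauge theories in a background field*, Commun. Math. Phys. **99** (1985) 389–434
[`Balaban1985BackgroundPropagators`, "B9"]; [4] = T. Bałaban, *Propagators and renormalization transformations for lattice gauge
theories. II*, Commun. Math. Phys. **96** (1984) 223–250 [`Balaban1984PropagatorsII`].

statement-level skeleton of published theorems with citation tags; proofs where landed; nothing here is a claim about the
Yang–Mills mass gap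

THE PRINTED LOCI.  (3.40) p. 397; (3.43) p. 398 read for Thm 3.3's `G` (p. 399) and for Thm 3.4's `G(U′U)` (p. 400, p. 403 l. 1–9: the letters `∇_U`, `U(Γ)` of the
base `U`); (3.3) p. 390, (3.8) p. 392 with (3.5) p. 391 (`∇_ν = −∇*_ν∘T_ν`); (3.27) p. 395 (`G = Δ_a⁻¹`); [4] (2.51)–(2.52) p. 232 (block majorants, block pieces), (2.54)
p. 233, Lemma 2.1 p. 234.

WHY THIS FILE (seat dag-n06-c gen 14).  The letters-level (3.43) frame of the bond family (`B9SectBH1GFrameV5.H1GFrame₅.h1G_transfer`, r06's per-PROBE Hölder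
transfers `thm34_G_holder_clause_uniform_blk`) speaks of real-linear functionals `Φ : (κ × S → 𝔸) →ₗ[ℝ] 𝔸` applied to `coord⁻¹(D(Gb μ))` for block-supported real
coordinate vectors `μ` on `(κ × S) × ι`, with `Gb := GbC` (gen 13's instance `B9SectBGFrameCodedY.gFrame₅CodedOn`); gen 14's `B9SectBH1GReadWriteY` speaks of def-Y's
bond quotient `holderQB` of the words `∇_{U,ν}G(W)Λ`, `G(W)∇*_{U,ν}Λ`.  THIS FILE is the dictionary between the two (bond twin of gen 12's `B9SectBH1ProbesY`):
* §1 `coordEquiv_symm_conj_apply` (any carrier), ★ `lamB b μ := bondFunCoords⁻¹(coord⁻¹ μ)` (the `𝔸`-valued bond function of a coordinate vector), `lamB_eq_sum_liftY`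
  (`= Σ_j μ(·,j) ⊗ b_j`), `lamB_conj_bondOpCoordsRY` (`lamB (conj b (T̂) μ) = T (lamB μ)`);
* §2 THE BRIDGES: `lamB_GbC` (`= G(dec c)(lamB μ)`), `lamB_DL_GbC` (`= ∇_{U,ν}G(dec c)(lamB μ)`), `lamB_GbC_DR` (`= G(dec c)∇*_{U,ν}(lamB μ)`), and the r06-syntax right
  letters `conj b (diffLetter (bT shiftY) (bU (UboxY U)) |c_f| k)` up to sign (`norm_map_symm_mul_diffLetter_inr∕inl`: for every ℝ-linear `Φ` the probe norms agree with
  those of `Gb * conj b (cdsBₗ̂)` ∕ `Gb * conj b (cdBₗ̂)`);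
* §3 ★ `probeBC` — the pair probe ON r06's CARRIER (`probeB ∘ bondFunCoords⁻¹`; `probeBC (coord⁻¹ v) = probeB (lamB v)`);
* §4 block-support tools: `blkC_snd_eq_blkV1`, ★ `blockSupp_coordEquiv_bondFun_liftY` (coordinates of an amplitude `J ⊗ E` are block-supported), the slices of a
  block-supported `μ` (`suppIn_slice`, `supNorm_slice_le`, `h1ReadB_slice_le`), ★ `probeL∕R_lamB_le` (the two printed words at `lamB μ`), ★ `norm_lamB_le_of_hasMajorant`
  (values of `lamB (T μ)` from a block majorant of `T`);
* §5 ★★ `probe_crossB_liftY_le` ∕ `probe_crossB_lamB_le` — THE RIGHT-FORWARD CROSS WORD `G(U)∇_{U,ν}Λ` (not a printed (3.43) orientation; r06's premise (b′) asks every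
  right letter): `∇_ν = −∇*_ν∘T_ν` (def-Y `OpsYRead342CrossB.cdB_eq_neg_cdsB_transport`), the transported amplitude split into its block pieces over the radius-`2(d+1)`
  neighbourhood of the input block, each piece read by the printed right word.
HONEST SCOPE.  Elementary bookkeeping over def-Y's and dag-n06-c's landed definitions; nothing of [B9] asserted; COUNT-NEUTRAL; N06 NOT discharged; one finite
lattice programme at fixed ε — nothing continuum, nothing about OS positivity or the mass gap.  No `sorry`, no `axiom`, no `instance`, no `notation`.
Cell `pub-ymgap` (HUMAN RULING D-0062), Track A node N06 [B9] row 13, seat `pub-ymgap-dag-n06-c` (g14), 2026-08-28; `--supports stmt-QuantumFields-27364`.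

RELATED IN THE TREE, NOT DUPLICATED: `B9SectBH1ProbesY` (site twin, gen 12), `B9SectBGReadCodedY` (`bondReindexY`, `bondOpCoordsRY_cdBₗ∕cdsBₗ`, `diffLetter_abs_eq`,
`GbC_eq_conj_bondOpCoordsRY` — USED), `Node00.OpsYRead342CrossB` (`cdB_eq_neg_cdsB_transport`, `transportB_liftY_eq_sum`, `dist_blkV1_shift_le` — USED),
`Node00.OpsYBondCoords` (`bondCoordsY`, `bondFunCoordsY` — USED).
-/

noncomputable section

namespace Literature.MathematicalPhysics.QuantumFieldTheory.Balaban1983to89.B9SectBH1GProbesY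

open LatticeFieldCalculus (supDist)
open B9Eq39Adjoint (R R_smul R_zero R_sub R_add)
open B6GlobalChartV1 (PV blkV1 boxEquiv)
open B6Ineq2142KLevelV1 (β)
open B6KLevelCensusIndexV1 (KIdx Adm)
open B6RandomWalk (HasMajorant BlockSupp)
open B9Thm34Ext (toB6)
open B9GeoNormsKLevelV1 (geo9K)
open B9GeoLemma21KLevelV1 (geo9K_dist_triangle geo9K_len_pos)
open B9Eq310Hermitian (norm_R_le)
open B9Eq352DivFormLetters (conj coordEquiv coordEquiv_apply coordEquiv_symm_apply conj_neg norm_coordSymm_apply_le)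
open B9Eq352GradLetters (diffLetter)
open B9Eq371GradLetters (bT bU)
open B9CoReadingCoords (cdBₗ cdsBₗ cdBₗ_apply cdsBₗ_apply)
open B9BackgroundsKLevelV1 (shiftsV1)
open B9PinMembersKLevelV1 (MemberY geo9Y)
open B9Eq360DeltaPrimeAY (AfldY)
open B9SectBGpLettersY (blkC decY)
open B9SectBCodedCarrier (CCfg)
open B9RWSumsReadsNbr (nbr mem_nbr)
open B9Thm310CommutatorBound389B (abs_le_supNorm_inr)
open Node00 (SiteY BlkY FBondY IBondY CfgY BallY SiteParY BondParY liftY liftY_apply holderQB cdB cdsB UboxY shiftY GAY GpY bondCoordsY bondFunCoordsY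
  bondFunCoordsY_apply bondFunCoordsY_symm_apply bondCoordsY_apply_snd)
open Node00.OpsYRead342CrossB (cdB_eq_neg_cdsB_transport transportB_liftY_eq_sum dist_blkV1_shift_le blkC_boxEquiv_src)
open B9SectBGWordDeltaAY (bondOpCoordsRY bondOpCoordsRY_apply GbC)
open B9SectBGReadCodedY (bondOpCoordsRY_cdBₗ bondOpCoordsRY_cdsBₗ diffLetter_abs_eq GbC_eq_conj_bondOpCoordsRY)
open B9SectBH1GReadWriteY (probeB probeB_apply norm_probeB norm_probeB_smul norm_probeB_sum_le norm_probeB_neg h1ReadB probeL_le_h1ReadB probeR_le_h1ReadB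
  probeL_sum_le_of_h1ReadB probeR_sum_le_of_h1ReadB liftY_eq_norm_smul_unit' unitBall liftY_finset_sum' wordL_apply wordR_apply)

variable {d ℓ : ℕ} {hd : 1 ≤ d + 1} {hL : Odd (ℓ + 1) ∧ 1 < ℓ + 1} {b₀ b₁ : ℝ}
variable {𝔸 : Type} [NormedRing 𝔸] [NormedAlgebra ℂ 𝔸] [CompleteSpace 𝔸]
variable {ι : Type} [Fintype ι] (i : KIdx d ℓ hd hL b₀ b₁) (b : Module.Basis ι ℝ 𝔸)

/-! ## §1 The input function of a coordinate vector -/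

omit [CompleteSpace 𝔸] in
/-- `coord⁻¹(conj b T v) = T(coord⁻¹ v)`, any carrier. [cite: Balaban1984PropagatorsII, (2.51) p.232, bookkeeping] -/
theorem coordEquiv_symm_conj_apply {S : Type} (T : Module.End ℝ (S → 𝔸)) (v : S × ι → ℝ) :
    (coordEquiv b).symm (conj b T v) = T ((coordEquiv b).symm v) := by
  rw [conj, LinearEquiv.conj_apply_apply, LinearEquiv.symm_apply_apply]

/-- ★ **THE `𝔸`-VALUED BOND FUNCTION OF A REAL COORDINATE VECTOR** on r06's bond carrier `(κ × SiteY) × ι`: `lamB μ := bondFunCoords⁻¹(coord⁻¹ μ)` — the input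
of def-Y's bond letters that the frame's `Gb μ` acts on. [cite: Balaban1985BackgroundPropagators, (3.1) p.390, (3.39) p.397; Balaban1984PropagatorsII, (2.51) p.232] -/
def lamB (μ : (Fin (d + 1) × SiteY i) × ι → ℝ) : FBondY i → 𝔸 := (bondFunCoordsY (𝔸 := 𝔸) i).symm ((coordEquiv b).symm μ)

omit [CompleteSpace 𝔸] in
/-- `lamB μ` at a bond: `Σ_j μ((dir, charted source), j)·b_j`. [cite: Balaban1984PropagatorsII, (2.51) p.232, bookkeeping] -/
theorem lamB_apply (μ : (Fin (d + 1) × SiteY i) × ι → ℝ) (q : FBondY i) : lamB i b μ q = ∑ j, μ (bondCoordsY i q, j) • b j := by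
  rw [lamB, bondFunCoordsY_symm_apply, coordEquiv_symm_apply]

omit [CompleteSpace 𝔸] in
/-- `lamB μ` is `coord⁻¹ μ` read at the bond coordinates. [cite: Balaban1984PropagatorsII, (2.51) p.232, bookkeeping] -/
theorem lamB_apply' (μ : (Fin (d + 1) × SiteY i) × ι → ℝ) (q : FBondY i) : lamB i b μ q = (coordEquiv b).symm μ (bondCoordsY i q) := by
  rw [lamB, bondFunCoordsY_symm_apply]

omit [CompleteSpace 𝔸] in
/-- ★ `lamB μ = Σ_j μ(·,j) ⊗ b_j` (the slices as amplitudes). [cite: Balaban1985BackgroundPropagators, (3.39) p.397; Balaban1984PropagatorsII, (2.51) p.232] -/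
theorem lamB_eq_sum_liftY (μ : (Fin (d + 1) × SiteY i) × ι → ℝ) : lamB i b μ = ∑ j, liftY (fun q : FBondY i => μ (bondCoordsY i q, j)) (b j) := by
  funext q
  rw [lamB_apply, Finset.sum_apply]
  refine Finset.sum_congr rfl fun j _ => ?_
  rw [liftY_apply, Complex.coe_smul]

omit [CompleteSpace 𝔸] in
/-- `lamB` inverts the coordinates of a bond function. [cite: Balaban1984PropagatorsII, (2.51) p.232, bookkeeping] -/
theorem lamB_coordEquiv_bondFunCoordsY (A : FBondY i → 𝔸) : lamB i b (coordEquiv b (bondFunCoordsY i A)) = A := by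
  rw [lamB, LinearEquiv.symm_apply_apply, LinearEquiv.symm_apply_apply]

omit [CompleteSpace 𝔸] in
/-- ★ a conjugated coordinate-changed bond operator acts on `lamB`: `lamB (conj b (bondOpCoordsRY T) μ) = T (lamB μ)`.
[cite: Balaban1984PropagatorsII, (2.51)–(2.52) p.232; Balaban1985BackgroundPropagators, (3.1) p.390, bookkeeping] -/
theorem lamB_conj_bondOpCoordsRY (T : Module.End ℝ (FBondY i → 𝔸)) (μ : (Fin (d + 1) × SiteY i) × ι → ℝ) :
    lamB i b (conj b (bondOpCoordsRY i T) μ) = T (lamB i b μ) := by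
  rw [lamB, coordEquiv_symm_conj_apply, bondOpCoordsRY_apply, LinearEquiv.symm_apply_apply]; rfl

/-! ## §2 The bridges to the letters of the G frame -/

section Bridges

variable {Mstar : ℕ} (x : MemberY d ℓ hd hL b₀ b₁ Mstar) (parS : SiteParY 𝔸 x.toKIdx) (parB : BondParY 𝔸 x.toKIdx)

/-- ★ BRIDGE 0 (`G` itself): `lamB (GbC c μ) = G(dec c)(lamB μ)` with `G := GAY parS parB (GpY parS)`. [cite: Balaban1985BackgroundPropagators, (3.27) p.395, Thm 3.3 p.399; Balaban1984PropagatorsII, (2.51) p.232] -/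
theorem lamB_GbC (c : CCfg (CfgY 𝔸 x.toKIdx) (AfldY 𝔸 x.toKIdx)) (μ : (Fin (d + 1) × SiteY x.toKIdx) × ι → ℝ) :
    lamB x.toKIdx b (GbC x.toKIdx parS parB b c μ) = GAY x.toKIdx parS parB (GpY x.toKIdx parS) (decY x.toKIdx c) (lamB x.toKIdx b μ) := by
  rw [GbC_eq_conj_bondOpCoordsRY, lamB_conj_bondOpCoordsRY]; rfl

/-- ★ BRIDGE L (the printed left word): `lamB ((conj b (cdBₗ̂ U ν) * GbC c) μ) = ∇_{U,ν}(G(dec c)(lamB μ))`.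
[cite: Balaban1985BackgroundPropagators, (3.43) p.398 («ζ∇_U Gλ»), (3.3) p.390; Balaban1984PropagatorsII, (2.51)–(2.52) p.232] -/
theorem lamB_DL_GbC (U : CfgY 𝔸 x.toKIdx) (ν : Fin (d + 1)) (c : CCfg (CfgY 𝔸 x.toKIdx) (AfldY 𝔸 x.toKIdx))
    (μ : (Fin (d + 1) × SiteY x.toKIdx) × ι → ℝ) :
    lamB x.toKIdx b ((conj b (bondOpCoordsRY x.toKIdx (cdBₗ x.toKIdx U ν)) * GbC x.toKIdx parS parB b c) μ) =
      cdB x.toKIdx U ν (GAY x.toKIdx parS parB (GpY x.toKIdx parS) (decY x.toKIdx c) (lamB x.toKIdx b μ)) := by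
  rw [Module.End.mul_apply, lamB_conj_bondOpCoordsRY, lamB_GbC]; rfl

/-- ★ BRIDGE R (the printed right word): `lamB ((GbC c * conj b (cdsBₗ̂ U ν)) μ) = G(dec c)(∇*_{U,ν}(lamB μ))`.
[cite: Balaban1985BackgroundPropagators, (3.43) p.398 («ζG∇*_Uλ»), (3.8) p.392; Balaban1984PropagatorsII, (2.51)–(2.52) p.232] -/
theorem lamB_GbC_DR (U : CfgY 𝔸 x.toKIdx) (ν : Fin (d + 1)) (c : CCfg (CfgY 𝔸 x.toKIdx) (AfldY 𝔸 x.toKIdx))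
    (μ : (Fin (d + 1) × SiteY x.toKIdx) × ι → ℝ) :
    lamB x.toKIdx b ((GbC x.toKIdx parS parB b c * conj b (bondOpCoordsRY x.toKIdx (cdsBₗ x.toKIdx U ν))) μ) =
      GAY x.toKIdx parS parB (GpY x.toKIdx parS) (decY x.toKIdx c) (cdsB x.toKIdx U ν (lamB x.toKIdx b μ)) := by
  rw [Module.End.mul_apply, lamB_GbC, lamB_conj_bondOpCoordsRY]; rfl

/-- BRIDGE R′ (the right-forward cross word): `lamB ((GbC c * conj b (cdBₗ̂ U ν)) μ) = G(dec c)(∇_{U,ν}(lamB μ))`.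
[cite: Balaban1985BackgroundPropagators, (3.3) p.390, (3.42) p.397 (not a printed orientation); Balaban1984PropagatorsII, (2.51)–(2.52) p.232] -/
theorem lamB_GbC_DF (U : CfgY 𝔸 x.toKIdx) (ν : Fin (d + 1)) (c : CCfg (CfgY 𝔸 x.toKIdx) (AfldY 𝔸 x.toKIdx))
    (μ : (Fin (d + 1) × SiteY x.toKIdx) × ι → ℝ) :
    lamB x.toKIdx b ((GbC x.toKIdx parS parB b c * conj b (bondOpCoordsRY x.toKIdx (cdBₗ x.toKIdx U ν))) μ) =
      GAY x.toKIdx parS parB (GpY x.toKIdx parS) (decY x.toKIdx c) (cdB x.toKIdx U ν (lamB x.toKIdx b μ)) := by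
  rw [Module.End.mul_apply, lamB_GbC, lamB_conj_bondOpCoordsRY]; rfl

end Bridges

section Letters

/-- ★ the r06-syntax BACKWARD right letter up to sign: for every ℝ-linear `Φ` and every `Gb`,
`‖Φ(coord⁻¹((Gb * conj b (diffLetter (bT shiftY) (bU (UboxY U)) |c_f| (inr ν))) μ))‖ = ‖Φ(coord⁻¹((Gb * conj b (cdsBₗ̂ U ν)) μ))‖` (`cdsBₗ̂ = −diffLetter … c_f (inr ν)`,
the letters with `|c_f|` and `c_f` agree up to sign). [cite: Balaban1985BackgroundPropagators, (3.8) p.392, (3.43) p.398; Balaban1984PropagatorsII, (2.51)–(2.52) p.232] -/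
theorem norm_map_symm_mul_diffLetter_inr {F : Type} [SeminormedAddCommGroup F] [Module ℝ F] (Φ : (Fin (d + 1) × SiteY i → 𝔸) →ₗ[ℝ] F)
    (Gb : Module.End ℝ ((Fin (d + 1) × SiteY i) × ι → ℝ)) (U : CfgY 𝔸 i) (ν : Fin (d + 1)) (μ : (Fin (d + 1) × SiteY i) × ι → ℝ) :
    ‖Φ ((coordEquiv b).symm ((Gb * conj b (diffLetter (bT (shiftY i)) (bU (UboxY i U)) ((|i.cf| : ℝ) : ℂ) (Sum.inr ν))) μ))‖ =
      ‖Φ ((coordEquiv b).symm ((Gb * conj b (bondOpCoordsRY i (cdsBₗ i U ν))) μ))‖ := by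
  rcases diffLetter_abs_eq (bT (shiftY i)) (bU (UboxY i U)) i.cf (Sum.inr ν) with h | h
  · rw [h, bondOpCoordsRY_cdsBₗ, conj_neg]
    simp only [Module.End.mul_apply, LinearMap.neg_apply, map_neg, norm_neg]
  · rw [h, bondOpCoordsRY_cdsBₗ]

/-- ★ the r06-syntax FORWARD right letter up to sign: `‖Φ(coord⁻¹((Gb * conj b (diffLetter … |c_f| (inl ν))) μ))‖ = ‖Φ(coord⁻¹((Gb * conj b (cdBₗ̂ U ν)) μ))‖`.
[cite: Balaban1985BackgroundPropagators, (3.3) p.390, (3.43) p.398; Balaban1984PropagatorsII, (2.51)–(2.52) p.232] -/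
theorem norm_map_symm_mul_diffLetter_inl {F : Type} [SeminormedAddCommGroup F] [Module ℝ F] (Φ : (Fin (d + 1) × SiteY i → 𝔸) →ₗ[ℝ] F)
    (Gb : Module.End ℝ ((Fin (d + 1) × SiteY i) × ι → ℝ)) (U : CfgY 𝔸 i) (ν : Fin (d + 1)) (μ : (Fin (d + 1) × SiteY i) × ι → ℝ) :
    ‖Φ ((coordEquiv b).symm ((Gb * conj b (diffLetter (bT (shiftY i)) (bU (UboxY i U)) ((|i.cf| : ℝ) : ℂ) (Sum.inl ν))) μ))‖ =
      ‖Φ ((coordEquiv b).symm ((Gb * conj b (bondOpCoordsRY i (cdBₗ i U ν))) μ))‖ := by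
  rcases diffLetter_abs_eq (bT (shiftY i)) (bU (UboxY i U)) i.cf (Sum.inl ν) with h | h
  · rw [h, bondOpCoordsRY_cdBₗ]
  · rw [h, bondOpCoordsRY_cdBₗ, conj_neg]
    simp only [Module.End.mul_apply, LinearMap.neg_apply, map_neg, norm_neg]

end Letters

/-! ## §3 The pair probe on r06's carrier -/

section Probe

variable (par : Site (PV d ℓ i.m i.K hd hL) 0 → Site (PV d ℓ i.m i.K hd hL) 0 → 𝔸ˣ)

/-- ★ **THE PAIR PROBE ON r06's BOND CARRIER**: `probeBC := probeB ∘ bondFunCoords⁻¹` — the `Φ : (κ × S → 𝔸) →ₗ[ℝ] 𝔸` of the frame's transfer field.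
[cite: Balaban1985BackgroundPropagators, (3.40) p.397, (3.43) p.398; Balaban1984PropagatorsII, (2.51) p.232] -/
def probeBC (α : ℝ) (ζ : FBondY i → ℝ) (x x' : FBondY i) : (Fin (d + 1) × SiteY i → 𝔸) →ₗ[ℝ] 𝔸 :=
  probeB i par α ζ x x' ∘ₗ ((bondFunCoordsY (𝔸 := 𝔸) i).symm.toLinearMap.restrictScalars ℝ)

omit [CompleteSpace 𝔸] in
/-- `probeBC` applied. [cite: Balaban1985BackgroundPropagators, (3.40) p.397, bookkeeping] -/
theorem probeBC_apply (α : ℝ) (ζ : FBondY i → ℝ) (x x' : FBondY i) (g : Fin (d + 1) × SiteY i → 𝔸) :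
    probeBC i par α ζ x x' g = probeB i par α ζ x x' ((bondFunCoordsY i).symm g) := rfl

omit [CompleteSpace 𝔸] in
/-- ★ the carrier probe at `coord⁻¹ v` IS the bond probe at `lamB v`. [cite: Balaban1985BackgroundPropagators, (3.40) p.397; Balaban1984PropagatorsII, (2.51) p.232] -/
theorem probeBC_symm (α : ℝ) (ζ : FBondY i → ℝ) (x x' : FBondY i) (v : (Fin (d + 1) × SiteY i) × ι → ℝ) :
    probeBC i par α ζ x x' ((coordEquiv b).symm v) = probeB i par α ζ x x' (lamB i b v) := rfl

omit [CompleteSpace 𝔸] in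
/-- the carrier probe at the coordinates of a bond function IS the bond probe there. [cite: Balaban1985BackgroundPropagators, (3.40) p.397, bookkeeping] -/
theorem probeBC_bondFunCoordsY (α : ℝ) (ζ : FBondY i → ℝ) (x x' : FBondY i) (A : FBondY i → 𝔸) :
    probeBC i par α ζ x x' (bondFunCoordsY i A) = probeB i par α ζ x x' A := by
  rw [probeBC_apply, LinearEquiv.symm_apply_apply]

end Probe

/-! ## §4 Block-support tools on r06's bond carrier -/

section BlockTools

variable (ιB : BlkY i → IBondY i) [Fintype (geo9K i).Site] {Rr : ℝ} {Hp : Prop}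

omit [NormedRing 𝔸] [NormedAlgebra ℂ 𝔸] [CompleteSpace 𝔸] [Fintype ι] [Fintype (geo9K i).Site] in
/-- the block of a carrier point is the labelled block of the bond it coordinatises. [cite: Balaban1984PropagatorsII, (2.45)–(2.46) p.231, dictionary] -/
theorem blkC_snd_eq_blkV1 (p : (Fin (d + 1) × SiteY i) × ι) : blkC i ιB p.1.2 = ιB (blkV1 i.hN i.D ((bondCoordsY i).symm p.1)) := by
  conv_lhs => rw [← (bondCoordsY i).apply_symm_apply p.1]
  rfl

omit [NormedRing 𝔸] [NormedAlgebra ℂ 𝔸] [CompleteSpace 𝔸] [Fintype ι] [Fintype (geo9K i).Site] in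
/-- the block of the coordinates of a bond. [cite: Balaban1984PropagatorsII, (2.45)–(2.46) p.231, dictionary] -/
theorem blkC_bondCoordsY_snd (q : FBondY i) : blkC i ιB (bondCoordsY i q).2 = ιB (blkV1 i.hN i.D q) := rfl

omit [CompleteSpace 𝔸] in
/-- ★ **THE COORDINATES OF A BOND AMPLITUDE ARE BLOCK-SUPPORTED**: for `supp J ⊂ Δ(βy′)` and `‖E‖ ≦ 1`, `coord(bondFunCoords(J ⊗ E))` is supported in the labelled
block `ιB(βy′)` with `|·| ≦ M₂|J|`. [cite: Balaban1984PropagatorsII, (2.51) p.232; Balaban1985BackgroundPropagators, (3.39) p.397] -/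
theorem blockSupp_coordEquiv_bondFun_liftY {M₂ : ℝ} (hM₂ : 0 ≤ M₂) (hrepr : ∀ (v : 𝔸) (j : ι), |b.repr v j| ≤ M₂ * ‖v‖)
    (J : FBondY i → ℝ) (y' : IBondY i) (hs : (geo9K i).suppIn (Sum.inr J) y') {E : 𝔸} (hE : ‖E‖ ≤ 1) :
    BlockSupp (g := toB6 (geo9K i) Rr Hp) (fun p : (Fin (d + 1) × SiteY i) × ι => blkC i ιB p.1.2) (coordEquiv b (bondFunCoordsY i (liftY J E)))
      (ιB (β i.hN i.D i.hk y')) (M₂ * (geo9K i).supNorm (Sum.inr J)) := by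
  have hN0 : 0 ≤ (geo9K i).supNorm (Sum.inr J) := Real.iSup_nonneg fun q => abs_nonneg _
  refine ⟨mul_nonneg hM₂ hN0, fun p _ => ?_, fun p hp => ?_⟩
  · rw [coordEquiv_apply, bondFunCoordsY_apply, liftY_apply, Complex.coe_smul, map_smul, Finsupp.smul_apply, smul_eq_mul, abs_mul]
    calc |J ((bondCoordsY i).symm p.1)| * |b.repr E p.2| ≤ (geo9K i).supNorm (Sum.inr J) * (M₂ * ‖E‖) :=
          mul_le_mul (abs_le_supNorm_inr i J _) (hrepr E p.2) (abs_nonneg _) hN0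
      _ ≤ (geo9K i).supNorm (Sum.inr J) * M₂ := mul_le_mul_of_nonneg_left (mul_le_of_le_one_right hM₂ hE) hN0
      _ = M₂ * (geo9K i).supNorm (Sum.inr J) := mul_comm _ _
  · have hJ : J ((bondCoordsY i).symm p.1) = 0 := by
      by_contra hJ
      refine hp ?_
      rw [blkC_snd_eq_blkV1, hs _ hJ]
    rw [coordEquiv_apply, bondFunCoordsY_apply, liftY_apply, hJ, Complex.ofReal_zero, zero_smul, map_zero, Finsupp.zero_apply]

omit [NormedRing 𝔸] [NormedAlgebra ℂ 𝔸] [CompleteSpace 𝔸] [Fintype ι] in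
/-- the slices `μ(·,j)` of a block-supported `μ` are supported in the genuine block. [cite: Balaban1984PropagatorsII, (2.51) p.232, bookkeeping] -/
theorem suppIn_slice (hι : ∀ s, β i.hN i.D i.hk (ιB s) = s) {μ : (Fin (d + 1) × SiteY i) × ι → ℝ} {y'' : IBondY i} {M : ℝ}
    (hμ : BlockSupp (g := toB6 (geo9K i) Rr Hp) (fun p : (Fin (d + 1) × SiteY i) × ι => blkC i ιB p.1.2) μ y'' M) (j : ι) :
    (geo9K i).suppIn (Sum.inr fun q : FBondY i => μ (bondCoordsY i q, j)) y'' := by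
  intro q hq
  by_contra hneq
  refine hq (hμ.off (bondCoordsY i q, j) fun h => hneq ?_)
  have h' : ιB (blkV1 i.hN i.D q) = y'' := by rw [← blkC_bondCoordsY_snd i ιB q]; exact h
  rw [← h', hι]

omit [NormedRing 𝔸] [NormedAlgebra ℂ 𝔸] [CompleteSpace 𝔸] [Fintype ι] in
/-- the slices of a block-supported `μ` have sup norm `≦ M`. [cite: Balaban1984PropagatorsII, (2.51) p.232, bookkeeping] -/
theorem supNorm_slice_le {μ : (Fin (d + 1) × SiteY i) × ι → ℝ} {y'' : IBondY i} {M : ℝ}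
    (hμ : BlockSupp (g := toB6 (geo9K i) Rr Hp) (fun p : (Fin (d + 1) × SiteY i) × ι => blkC i ιB p.1.2) μ y'' M) (j : ι) :
    (geo9K i).supNorm (Sum.inr fun q : FBondY i => μ (bondCoordsY i q, j)) ≤ M := by
  refine Real.iSup_le (fun q => ?_) hμ.nonneg
  show |μ (bondCoordsY i q, j)| ≤ M
  by_cases hq : blkC i ιB (bondCoordsY i q).2 = y''
  · exact hμ.bound (bondCoordsY i q, j) hq
  · rw [hμ.off (bondCoordsY i q, j) hq, abs_zero]; exact hμ.nonneg

variable (T : (FBondY i → 𝔸) →ₗ[ℂ] (FBondY i → 𝔸)) (par : Site (PV d ℓ i.m i.K hd hL) 0 → Site (PV d ℓ i.m i.K hd hL) 0 → 𝔸ˣ) (U : CfgY 𝔸 i)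

omit [Fintype ι] in
/-- reading bounds for the slices of a block-supported `μ`. [cite: Balaban1985BackgroundPropagators, (3.43) p.398; Balaban1984PropagatorsII, (2.51) p.232, bookkeeping] -/
theorem h1ReadB_slice_le (hι : ∀ s, β i.hN i.D i.hk (ιB s) = s) (α : ℝ) (ζ : FBondY i → ℝ) {W : IBondY i → ℝ} (hW0 : ∀ a, 0 ≤ W a)
    (hread : ∀ (g : FBondY i → ℝ) (a : IBondY i), (geo9K i).suppIn (Sum.inr g) a → h1ReadB i T par U g α ζ ≤ W a * (geo9K i).supNorm (Sum.inr g))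
    {μ : (Fin (d + 1) × SiteY i) × ι → ℝ} {y'' : IBondY i} {M : ℝ}
    (hμ : BlockSupp (g := toB6 (geo9K i) Rr Hp) (fun p : (Fin (d + 1) × SiteY i) × ι => blkC i ιB p.1.2) μ y'' M) (j : ι) :
    h1ReadB i T par U (fun q : FBondY i => μ (bondCoordsY i q, j)) α ζ ≤ W y'' * M :=
  (hread _ y'' (suppIn_slice i ιB hι hμ j)).trans (mul_le_mul_of_nonneg_left (supNorm_slice_le i ιB hμ j) (hW0 y''))

/-- ★ **READ, LEFT WORD, BLOCK-SUPPORTED INPUT**: the admissible pair probe of `∇_{U,ν}T(lamB μ)`, `μ` supported in the labelled block `y″` with `|μ| ≦ M`, is at most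
`(Σ_j‖b_j‖)·W(y″)·M` under the reading bounds `h1ReadB T par U g α ζ ≦ W(a)|g|` (`supp g ⊂ Δ(βa)`).
[cite: Balaban1985BackgroundPropagators, (3.43) p.398 (first word), (3.40) p.397; Balaban1984PropagatorsII, (2.51)–(2.52) p.232] -/
theorem probeL_lamB_le (hι : ∀ s, β i.hN i.D i.hk (ιB s) = s) {M₂ : ℝ} (hM₂ : 0 ≤ M₂) (hrepr : ∀ (v : 𝔸) (j : ι), |b.repr v j| ≤ M₂ * ‖v‖)
    (α : ℝ) (ζ : FBondY i → ℝ) {W : IBondY i → ℝ} (hW0 : ∀ a, 0 ≤ W a)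
    (hread : ∀ (g : FBondY i → ℝ) (a : IBondY i), (geo9K i).suppIn (Sum.inr g) a → h1ReadB i T par U g α ζ ≤ W a * (geo9K i).supNorm (Sum.inr g))
    {μ : (Fin (d + 1) × SiteY i) × ι → ℝ} {y'' : IBondY i} {M : ℝ}
    (hμ : BlockSupp (g := toB6 (geo9K i) Rr Hp) (fun p : (Fin (d + 1) × SiteY i) × ι => blkC i ιB p.1.2) μ y'' M)
    (ν : Fin (d + 1)) {x x' : FBondY i} (hadm : Adm i x x') :
    ‖probeB i par α ζ x x' (cdB i U ν (T (lamB i b μ)))‖ ≤ (∑ j, ‖b j‖) * (W y'' * M) := by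
  rw [lamB_eq_sum_liftY, Finset.sum_mul]
  exact probeL_sum_le_of_h1ReadB i b T par U hM₂ hrepr α ζ (fun j q => μ (bondCoordsY i q, j)) (fun _ => W y'' * M)
    (fun j => h1ReadB_slice_le i ιB T par U hι α ζ hW0 hread hμ j) ν hadm

/-- ★ **READ, RIGHT WORD, BLOCK-SUPPORTED INPUT.** [cite: Balaban1985BackgroundPropagators, (3.43) p.398 (second word), (3.40) p.397; Balaban1984PropagatorsII, (2.51)–(2.52) p.232] -/
theorem probeR_lamB_le (hι : ∀ s, β i.hN i.D i.hk (ιB s) = s) {M₂ : ℝ} (hM₂ : 0 ≤ M₂) (hrepr : ∀ (v : 𝔸) (j : ι), |b.repr v j| ≤ M₂ * ‖v‖)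
    (α : ℝ) (ζ : FBondY i → ℝ) {W : IBondY i → ℝ} (hW0 : ∀ a, 0 ≤ W a)
    (hread : ∀ (g : FBondY i → ℝ) (a : IBondY i), (geo9K i).suppIn (Sum.inr g) a → h1ReadB i T par U g α ζ ≤ W a * (geo9K i).supNorm (Sum.inr g))
    {μ : (Fin (d + 1) × SiteY i) × ι → ℝ} {y'' : IBondY i} {M : ℝ}
    (hμ : BlockSupp (g := toB6 (geo9K i) Rr Hp) (fun p : (Fin (d + 1) × SiteY i) × ι => blkC i ιB p.1.2) μ y'' M)
    (ν : Fin (d + 1)) {x x' : FBondY i} (hadm : Adm i x x') :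
    ‖probeB i par α ζ x x' (T (cdsB i U ν (lamB i b μ)))‖ ≤ (∑ j, ‖b j‖) * (W y'' * M) := by
  rw [lamB_eq_sum_liftY, Finset.sum_mul]
  exact probeR_sum_le_of_h1ReadB i b T par U hM₂ hrepr α ζ (fun j q => μ (bondCoordsY i q, j)) (fun _ => W y'' * M)
    (fun j => h1ReadB_slice_le i ιB T par U hι α ζ hW0 hread hμ j) ν hadm

omit [CompleteSpace 𝔸] in
/-- ★ **VALUES OF `lamB (T μ)` FROM A BLOCK MAJORANT OF `T`**: `‖lamB (T μ) q‖ ≦ (Σ_j‖b_j‖)·K(ιB y(q), y″)·M` for `μ` supported in the labelled block `y″`, `|μ| ≦ M`.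
[cite: Balaban1984PropagatorsII, (2.51) p.232 («|(Tλ)(x)| ≤ K(y,y′)|λ|»)] -/
theorem norm_lamB_le_of_hasMajorant {Tm : Module.End ℝ ((Fin (d + 1) × SiteY i) × ι → ℝ)} {K : IBondY i → IBondY i → ℝ}
    (hT : HasMajorant (g := toB6 (geo9K i) Rr Hp) (fun p : (Fin (d + 1) × SiteY i) × ι => blkC i ιB p.1.2) Tm K)
    {μ : (Fin (d + 1) × SiteY i) × ι → ℝ} {y'' : IBondY i} {M : ℝ}
    (hμ : BlockSupp (g := toB6 (geo9K i) Rr Hp) (fun p : (Fin (d + 1) × SiteY i) × ι => blkC i ιB p.1.2) μ y'' M) (q : FBondY i) :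
    ‖lamB i b (Tm μ) q‖ ≤ (∑ j, ‖b j‖) * (K (ιB (blkV1 i.hN i.D q)) y'' * M) := by
  rw [lamB_apply']
  exact norm_coordSymm_apply_le b (Tm μ) (bondCoordsY i q) _ fun j => hT y'' μ M hμ (bondCoordsY i q, j)

end BlockTools

/-! ## §5 The right-forward cross word `G(U)∇_{U,ν}` -/

section Cross

variable (ιB : BlkY i → IBondY i) [Fintype (geo9K i).Site]
  (T : (FBondY i → 𝔸) →ₗ[ℂ] (FBondY i → 𝔸)) (par : Site (PV d ℓ i.m i.K hd hL) 0 → Site (PV d ℓ i.m i.K hd hL) 0 → 𝔸ˣ) (U : CfgY 𝔸 i)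

/-- ★★ **THE RIGHT-FORWARD CROSS WORD AT A BOND AMPLITUDE**: from unit norms of the bond variables of `U`, a count `m_N` of the index bonds within `2(d+1)` of a bond, and
reading bounds `h1ReadB T par U g α ζ ≦ W(a)·|g|` for scalar inputs `g` supported in the block of `a` (`a` in the neighbourhood of `y′`, `W(a) ≦ W₀` there, `W ≧ 0`): the
admissible pair probe of `T∇_{U,ν}(J ⊗ E)` (`supp J ⊂ Δ(βy′)`, `‖E‖ ≦ 1`) is at most `m_N·M₂(Σ_j‖b_j‖)·W₀·|J|` — `∇_ν = −∇*_ν∘T_ν`, the transported amplitude split into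
its block pieces, the printed right word `T∇*_{U,ν}` read on each piece.
[cite: Balaban1985BackgroundPropagators, (3.43) p.398 (second word) with Thm 3.3 p.399, (3.3) p.390, (3.8) p.392, (3.40) p.397; Balaban1984PropagatorsII, (2.51)–(2.52) p.232, (2.54) p.233, Lemma 2.1 p.234] -/
theorem probe_crossB_liftY_le (hι : ∀ s, β i.hN i.D i.hk (ιB s) = s)
    {M₂ : ℝ} (hM₂ : 0 ≤ M₂) (hrepr : ∀ (v : 𝔸) (j : ι), |b.repr v j| ≤ M₂ * ‖v‖)
    (hU1 : ∀ (ν : Fin (d + 1)) (s : Site (PV d ℓ i.m i.K hd hL) 0), ‖((U ν s : 𝔸ˣ) : 𝔸)‖ ≤ 1 ∧ ‖(((U ν s)⁻¹ : 𝔸ˣ) : 𝔸)‖ ≤ 1)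
    {mN : ℕ} (hnbr : ∀ y' : IBondY i, (nbr (geo9K i) (2 * ((d : ℝ) + 1)) y').card ≤ mN)
    (α : ℝ) (ζ : FBondY i → ℝ) (y' : IBondY i) {W : IBondY i → ℝ} {W₀ : ℝ} (hW0 : ∀ a, 0 ≤ W a)
    (hW : ∀ a ∈ nbr (geo9K i) (2 * ((d : ℝ) + 1)) y', W a ≤ W₀)
    (hread : ∀ (g : FBondY i → ℝ) (a : IBondY i), (geo9K i).suppIn (Sum.inr g) a → h1ReadB i T par U g α ζ ≤ W a * (geo9K i).supNorm (Sum.inr g))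
    (J : FBondY i → ℝ) (hs : (geo9K i).suppIn (Sum.inr J) y') {E : 𝔸} (hE1 : ‖E‖ ≤ 1)
    (ν : Fin (d + 1)) {x x' : FBondY i} (hadm : Adm i x x') :
    ‖probeB i par α ζ x x' (T (cdB i U ν (liftY J E)))‖ ≤ ((mN : ℝ) * (M₂ * ∑ j, ‖b j‖) * W₀) * (geo9K i).supNorm (Sum.inr J) := by
  classical
  have hsup : 0 ≤ (geo9K i).supNorm (Sum.inr J) := (abs_nonneg _).trans (abs_le_supNorm_inr i J x)
  have hW₀ : ∀ a ∈ nbr (geo9K i) (2 * ((d : ℝ) + 1)) y', 0 ≤ W₀ := fun a ha => (hW0 a).trans (hW a ha)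
  -- the neighbourhood of the input block and the pieces of the transported amplitude
  set Tn : Finset (IBondY i) := nbr (geo9K i) (2 * ((d : ℝ) + 1)) y' with hTn
  set g : ι → FBondY i → ℝ := fun j q =>
    J ⟨shiftsV1 (PV d ℓ i.m i.K hd hL) ν q.src, q.dir⟩ * b.repr (R (U ν q.src) E) j with hg
  set gp : ι → IBondY i → FBondY i → ℝ := fun j a q => if ιB (blkV1 i.hN i.D q) = a then g j q else 0 with hgp
  -- (i) where `g_j ≠ 0` the block is in the neighbourhood of `y′`
  have hmemT : ∀ j q, g j q ≠ 0 → ιB (blkV1 i.hN i.D q) ∈ Tn := by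
    intro j q hq
    have hJ : J ⟨shiftsV1 (PV d ℓ i.m i.K hd hL) ν q.src, q.dir⟩ ≠ 0 := fun h0 => hq (by simp only [hg, h0, zero_mul])
    have hblk : blkV1 i.hN i.D ⟨shiftsV1 (PV d ℓ i.m i.K hd hL) ν q.src, q.dir⟩ = β i.hN i.D i.hk y' := hs _ hJ
    have hc : β i.hN i.D i.hk (ιB (blkV1 i.hN i.D ⟨shiftsV1 (PV d ℓ i.m i.K hd hL) ν q.src, q.dir⟩)) = β i.hN i.D i.hk y' := by rw [hι, hblk]
    refine mem_nbr.2 ?_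
    rw [← Node00.OpsYRead342.geo9K_dist_congr i rfl hc]
    exact dist_blkV1_shift_le i ιB hι ν q
  -- (ii) `g_j` is the sum of its pieces over the neighbourhood
  have hsplit : ∀ j, g j = ∑ a ∈ Tn, gp j a := by
    intro j; funext q
    rw [Finset.sum_apply]
    show g j q = ∑ a ∈ Tn, (if ιB (blkV1 i.hN i.D q) = a then g j q else 0)
    by_cases hq : g j q = 0
    · rw [hq]; symm
      exact Finset.sum_eq_zero fun a _ => ite_self 0
    · rw [Finset.sum_ite_eq, if_pos (hmemT j q hq)]
  -- (iii) the transported amplitude as a double sum of amplitudes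
  have hΨ : (fun q : FBondY i => R (U ν q.src) (liftY J E ⟨shiftsV1 (PV d ℓ i.m i.K hd hL) ν q.src, q.dir⟩)) = ∑ j, ∑ a ∈ Tn, liftY (gp j a) (b j) := by
    rw [transportB_liftY_eq_sum i b U ν J E]
    refine Finset.sum_congr rfl fun j _ => ?_
    show liftY (g j) (b j) = _
    rw [hsplit j, liftY_finset_sum']
  -- (iv) the word identity `T∇_ν(J ⊗ E) = −Σ_j Σ_a T∇*_ν(g_{j,a} ⊗ b_j)`
  have hword : T (cdB i U ν (liftY J E)) = -(∑ j, ∑ a ∈ Tn, T (cdsB i U ν (liftY (gp j a) (b j)))) := by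
    rw [cdB_eq_neg_cdsB_transport i U ν (liftY J E), hΨ, map_neg]
    congr 1
    rw [← wordR_apply, map_sum]
    refine Finset.sum_congr rfl fun j _ => ?_
    rw [map_sum]; rfl
  -- (v) each piece: the printed right word at the block `a`, the amplitude `b_j` rescaled into the ball
  have hpiece : ∀ j, ∀ a ∈ Tn, ‖probeB i par α ζ x x' (T (cdsB i U ν (liftY (gp j a) (b j))))‖ ≤ ‖b j‖ * (W₀ * (M₂ * (geo9K i).supNorm (Sum.inr J))) := by
    intro j a haT
    have hsa : (geo9K i).suppIn (Sum.inr (gp j a)) a := by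
      intro q hq
      have hqa : ιB (blkV1 i.hN i.D q) = a := by
        by_contra hna
        exact hq (show (if ιB (blkV1 i.hN i.D q) = a then g j q else 0) = 0 by rw [if_neg hna])
      rw [← hqa, hι]
    have hgsup : (geo9K i).supNorm (Sum.inr (gp j a)) ≤ M₂ * (geo9K i).supNorm (Sum.inr J) := by
      refine Real.iSup_le (fun q => ?_) (mul_nonneg hM₂ hsup)
      show |(if ιB (blkV1 i.hN i.D q) = a then g j q else 0)| ≤ _
      by_cases hqa : ιB (blkV1 i.hN i.D q) = a
      · rw [if_pos hqa]
        show |J ⟨shiftsV1 (PV d ℓ i.m i.K hd hL) ν q.src, q.dir⟩ * b.repr (R (U ν q.src) E) j| ≤ _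
        rw [abs_mul]
        have hR : ‖R (U ν q.src) E‖ ≤ 1 := (norm_R_le (hU1 ν q.src).1 (hU1 ν q.src).2 E).trans hE1
        calc |J ⟨shiftsV1 (PV d ℓ i.m i.K hd hL) ν q.src, q.dir⟩| * |b.repr (R (U ν q.src) E) j|
            ≤ (geo9K i).supNorm (Sum.inr J) * (M₂ * ‖R (U ν q.src) E‖) := mul_le_mul (abs_le_supNorm_inr i J _) (hrepr _ _) (abs_nonneg _) hsup
          _ ≤ (geo9K i).supNorm (Sum.inr J) * (M₂ * 1) := by gcongr
          _ = M₂ * (geo9K i).supNorm (Sum.inr J) := by ring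
      · rw [if_neg hqa, abs_zero]; exact mul_nonneg hM₂ hsup
    have hreadp : h1ReadB i T par U (gp j a) α ζ ≤ W₀ * (M₂ * (geo9K i).supNorm (Sum.inr J)) :=
      (hread (gp j a) a hsa).trans (mul_le_mul (hW a haT) hgsup ((abs_nonneg _).trans (abs_le_supNorm_inr i _ x)) (hW₀ a haT))
    have hbj : b j ≠ 0 := b.ne_zero j
    rw [liftY_eq_norm_smul_unit' (gp j a) hbj, ← wordR_apply, map_smul, wordR_apply, norm_probeB_smul, abs_norm]
    refine mul_le_mul_of_nonneg_left ?_ (norm_nonneg _)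
    exact (probeR_le_h1ReadB i b par T U hM₂ hrepr (gp j a) α ζ (unitBall (b j)) ν hadm).trans hreadp
  -- (vi) assemble
  have hcard : ((Tn.card : ℕ) : ℝ) ≤ mN := Nat.cast_le.2 (hnbr y')
  have hTne : y' ∈ Tn := mem_nbr.2 (B9SectBGpLettersY.stencil0_geo9K i y')
  calc ‖probeB i par α ζ x x' (T (cdB i U ν (liftY J E)))‖
      = ‖probeB i par α ζ x x' (∑ j, ∑ a ∈ Tn, T (cdsB i U ν (liftY (gp j a) (b j))))‖ := by rw [hword, norm_probeB_neg]
    _ ≤ ∑ j, ‖probeB i par α ζ x x' (∑ a ∈ Tn, T (cdsB i U ν (liftY (gp j a) (b j))))‖ := norm_probeB_sum_le i _ par α ζ x x' _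
    _ ≤ ∑ j, ∑ a ∈ Tn, ‖probeB i par α ζ x x' (T (cdsB i U ν (liftY (gp j a) (b j))))‖ :=
        Finset.sum_le_sum fun j _ => norm_probeB_sum_le i _ par α ζ x x' _
    _ ≤ ∑ j, ∑ a ∈ Tn, ‖b j‖ * (W₀ * (M₂ * (geo9K i).supNorm (Sum.inr J))) :=
        Finset.sum_le_sum fun j _ => Finset.sum_le_sum fun a ha => hpiece j a ha
    _ = (Tn.card : ℝ) * ((∑ j, ‖b j‖) * (W₀ * (M₂ * (geo9K i).supNorm (Sum.inr J)))) := by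
        rw [Finset.sum_comm, Finset.sum_const, nsmul_eq_mul, Finset.sum_mul]
    _ ≤ (mN : ℝ) * ((∑ j, ‖b j‖) * (W₀ * (M₂ * (geo9K i).supNorm (Sum.inr J)))) :=
        mul_le_mul_of_nonneg_right hcard (mul_nonneg (Finset.sum_nonneg fun j _ => norm_nonneg _)
          (mul_nonneg (hW₀ y' hTne) (mul_nonneg hM₂ hsup)))
    _ = ((mN : ℝ) * (M₂ * ∑ j, ‖b j‖) * W₀) * (geo9K i).supNorm (Sum.inr J) := by ring

/-- ★★ **THE RIGHT-FORWARD CROSS WORD AT A BLOCK-SUPPORTED INPUT** `lamB μ`, `μ` supported in the labelled block `y′` with `|μ| ≦ M`: the admissible pair probe of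
`T∇_{U,ν}(lamB μ)` is at most `(Σ_j‖b_j‖)·m_N·M₂(Σ_j‖b_j‖)·W₀·M`.
[cite: Balaban1985BackgroundPropagators, (3.43) p.398, (3.3) p.390, (3.8) p.392; Balaban1984PropagatorsII, (2.51)–(2.52) p.232, (2.54) p.233] -/
theorem probe_crossB_lamB_le (hι : ∀ s, β i.hN i.D i.hk (ιB s) = s)
    {M₂ : ℝ} (hM₂ : 0 ≤ M₂) (hrepr : ∀ (v : 𝔸) (j : ι), |b.repr v j| ≤ M₂ * ‖v‖)
    (hU1 : ∀ (ν : Fin (d + 1)) (s : Site (PV d ℓ i.m i.K hd hL) 0), ‖((U ν s : 𝔸ˣ) : 𝔸)‖ ≤ 1 ∧ ‖(((U ν s)⁻¹ : 𝔸ˣ) : 𝔸)‖ ≤ 1)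
    {mN : ℕ} (hnbr : ∀ y' : IBondY i, (nbr (geo9K i) (2 * ((d : ℝ) + 1)) y').card ≤ mN)
    (α : ℝ) (ζ : FBondY i → ℝ) (y' : IBondY i) {W : IBondY i → ℝ} {W₀ : ℝ} (hW0 : ∀ a, 0 ≤ W a)
    (hW : ∀ a ∈ nbr (geo9K i) (2 * ((d : ℝ) + 1)) y', W a ≤ W₀)
    (hread : ∀ (g : FBondY i → ℝ) (a : IBondY i), (geo9K i).suppIn (Sum.inr g) a → h1ReadB i T par U g α ζ ≤ W a * (geo9K i).supNorm (Sum.inr g))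
    {Rr : ℝ} {Hp : Prop} (μ : (Fin (d + 1) × SiteY i) × ι → ℝ) {M : ℝ}
    (hμ : BlockSupp (g := toB6 (geo9K i) Rr Hp) (fun p : (Fin (d + 1) × SiteY i) × ι => blkC i ιB p.1.2) μ y' M)
    (ν : Fin (d + 1)) {x x' : FBondY i} (hadm : Adm i x x') :
    ‖probeB i par α ζ x x' (T (cdB i U ν (lamB i b μ)))‖ ≤ (∑ j, ‖b j‖) * (((mN : ℝ) * (M₂ * ∑ j, ‖b j‖) * W₀) * M) := by
  classical
  have hM : 0 ≤ M := hμ.nonneg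
  have hw : T (cdB i U ν (lamB i b μ)) = ∑ j, T (cdB i U ν (liftY (fun q : FBondY i => μ (bondCoordsY i q, j)) (b j))) := by
    rw [lamB_eq_sum_liftY]
    have h1 : cdB i U ν (∑ j, liftY (fun q : FBondY i => μ (bondCoordsY i q, j)) (b j)) =
        ∑ j, cdB i U ν (liftY (fun q : FBondY i => μ (bondCoordsY i q, j)) (b j)) := by
      rw [← cdBₗ_apply, map_sum]; rfl
    rw [h1, map_sum]
  rw [hw, Finset.sum_mul]
  refine (norm_probeB_sum_le i _ par α ζ x x' _).trans (Finset.sum_le_sum fun j _ => ?_)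
  have hbj : b j ≠ 0 := b.ne_zero j
  have hsj := suppIn_slice i ιB hι hμ j
  have hsupj := supNorm_slice_le i ιB hμ j
  rw [liftY_eq_norm_smul_unit' (fun q : FBondY i => μ (bondCoordsY i q, j)) hbj, ← cdBₗ_apply, map_smul, cdBₗ_apply, LinearMap.map_smul_of_tower,
    norm_probeB_smul, abs_norm]
  refine mul_le_mul_of_nonneg_left ?_ (norm_nonneg _)
  have h := probe_crossB_liftY_le i b ιB T par U hι hM₂ hrepr hU1 hnbr α ζ y' hW0 hW hread (fun q => μ (bondCoordsY i q, j)) hsj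
    (B9SectBH1GReadWriteY.norm_inv_norm_smul_le_one (b j)) ν hadm
  refine h.trans (mul_le_mul_of_nonneg_left hsupj ?_)
  have hTne : y' ∈ nbr (geo9K i) (2 * ((d : ℝ) + 1)) y' := mem_nbr.2 (B9SectBGpLettersY.stencil0_geo9K i y')
  exact mul_nonneg (mul_nonneg (Nat.cast_nonneg _) (mul_nonneg hM₂ (Finset.sum_nonneg fun j _ => norm_nonneg _))) ((hW0 y').trans (hW y' hTne))

end Cross

end Literature.MathematicalPhysics.QuantumFieldTheory.Balaban1983to89.B9SectBH1GProbesY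

end
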